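import Summits.QuantumFields.BalabanUV.Beta.D1BFx.SplitInstanceS
import Summits.QuantumFields.BalabanUV.Beta.D1BFx.NeedleRowGlue

/-!
# `BalabanUV.Beta.D1BFx.NeedleRowGlueS` — road «BF-x», binder row D1, slot (K): THE NEEDLE GROUP OF THE TWO-PROFILE RE-CUT TABLE `restKS g (s•g)` FROM THE
# SAME EIGHT TABLE-ROW BOUNDS, variant «ENDₛ» (END-ii-SPEC v1.1 §3 (b)∕(c), owner «NEEDLE-GLUE-S»): the needle fibre's gluon words are the record's at `g`, its
# ghost words the record's at `s•g`, and ALL recombine to PROFILE-FREE tables over the full legs (`Ga`, `Ggh`) — so `NeedleRowGlue` transfers VERBATIM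

HONEST DEPENDENCY (page 1, mandatory): continuum YM on T⁴ ⇐ BetaPertH ∧ nine spine estimates (0/9 proved); BetaPertH ⇐ (D1) ∧ (D4) ∧
CAP+tail; G-an2-4 gates asym, D1 and NE2/3/4.  HONEST FRAMING (cell contract, verbatim): «discharging `BetaPertH` makes Bałaban's UV
stability UNCONDITIONAL — a real constructive-QFT result; it is NOT the continuum limit and NOT the Clay problem.»  THIS MODULE DISCHARGES
NOTHING of the wall: [folklore] finite-sum bookkeeping BY NAME over the owner's `NeedleGroupPointwise` recombinations (`sum_needleFibre'`, `sum_needleFibre`,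
`sum_needleBub_restK'`, `sum_needleGhBub_restK'`, `sum_needleTad_restK'`, `sum_needleGhTad_restK'` — each valid for ANY exponentially bounded profile), the
rfl transfers `SplitInstanceS.restKS_*_eq`, and `NeedleRowGlue`'s convergence lemmas; §2∕§3 are `NeedleRowGlue` §2∕§3 with `restK' g ↦ restKS g (s•g)`.
No `def`, no `Prop` minted, nothing cited, 0 sorry.  NOTHING is estimated here (the eight table rows stay displayed).  0 wall binders (root-level hW ∕ hR-sockets ∕
hSX-socket ∕ D1Tel ∕ D1Rep — 0); (K) NOT closed; NOT D1, NOT `BetaPertH`, NOT continuum, NOT Clay.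

ABSOLUTE RULE (cell charter, verbatim): «No internally-minted statement may enter as a cited fact. Every hypothesis is either kernel-proved in
this package or a verbatim quotation of a PUBLISHED theorem with page reference. The manuscript(s) under audit are NOT citable for their own
disputed steps — they are the thing under adjudication; programme-internal (2001/route/tribunal) claims are never citable.»

WHY (owner ruling ρ-g11-9 ∕ ρ-g11-11; an3-g64's edits list §3: T₄ T₅ T₆ T₇ are profile-free, the ONLY profile-dependent ghost rows are L-GBUB-ii).  The ENDₛ
END `RoadEndBFxTotalShellGroupsS` asks ONE bound per group of the two-profile words; at the needle label the group is `needleFibre'` (27 gluon bubble words,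
12 ghost bubble words, 3 slot-4 tadpoles, 2 ghost tadpoles).  THIS FILE shows its row is bounded by the SAME eight table-row constants as the record's —
T₁–T₃ ∕ T₈ (gluon, IN TREE at the ray: `GluonNeedleRowsT12`, `GluonNeedleRowT3`; T₈ open) and T₄–T₇ (ghost, full leg `Ggh`: under reading (ii) supplied by the
tolerance rows `NeedleGhostBubbleRowMass10{,T5}` ∕ `NeedleGhostBubble2RowMass8` ∕ `NeedleGhostTadpoleRowMass8` through `NeedleRowsAtRayS`).

CONTENT.
* §1 [folklore] **`sum_needleFibre'_restKS`** — pointwise recombination of the two-profile needle group into the eight profile-free tables.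
* §2 [folklore] **`fullSum_needleFibre'_eqS`** — its full sum at a base site = `n⁻⁸·(ωgl·(cE·FS₁ + cE·FS₂ + FS₃) + ωgh·(cKcQ·FS₄ + cQcK·FS₅ + cQ²·FS₆ + FS₇) + ωgl·cQ₂·FS₈)`.
* §3 [folklore] **`abs_gN_row_le_of_tablesS`** — IN THE END's CURRENCY: `|Σ_{b} n⁻⁴·fullSum (w ↦ Σ_{τ : grp τ = gN} restKS (gfrz n a b) (s n • gfrz n a b) … τ w)|
  ≤ C₁ + ⋯ + C₈` from the eight displayed table-row bounds `h₁ … h₈`, `hfib`, `0 < a`, `Spr (Ga n a)`, the slot-4 socket `hQ`, ANY `s : ℕ → ℝ`.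
Unit `b2b-balaban-beta-d1-p2` (gen 12), road «BF-x» OWNER, BINDER-OWNERS row D1 co-owner; `LEAVES-BFx.md` row «NEEDLE-GLUE-S»; END-ii-SPEC v1.1 §3 (b).
-/

noncomputable section

open Finset Filter Topology
open scoped BigOperators
open Literature.MathematicalPhysics.QuantumFieldTheory.Balaban1983to89
open Literature.MathematicalPhysics.QuantumFieldTheory.Balaban1983to89.Beta
open WindowIdentification (fullSum psum fullSum_const_mul)
open B12Sec2to5 (l1)
open DyadicShell (Pt toReal)
open ExpKernelCalculus (Site MKer BiLoc)
open DressedMomentNormalisation (resSite)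
open Summit.QuantumFields.BalabanUV.Beta.TameKernelCalculus (Spr)
open Summit.QuantumFields.BalabanUV.Beta.D1BFx.MomentTransferPeriodic (baseKer)
open Summit.QuantumFields.BalabanUV.Beta.D1BFx.GluonLeg (Ga)
open Summit.QuantumFields.BalabanUV.Beta.D1BFx.GhostLeg (Ggh spr_Ggh)
open Summit.QuantumFields.BalabanUV.Beta.D1BFx.GhostStencil (ghCur biLoc_ghCur)
open Summit.QuantumFields.BalabanUV.Beta.D1BFx.GhostStencilRooted (qAntiAt biLoc_qAntiAt)
open Summit.QuantumFields.BalabanUV.Beta.D1BFx.GhostStencilRootedReflection (ctrHalf ctrHalf_mem)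
open Summit.QuantumFields.BalabanUV.Beta.D1BFx.ReducedKernel (TableR)
open Summit.QuantumFields.BalabanUV.Beta.D1BFx.DressedTadpoleTable (tadpoleTable)
open Summit.QuantumFields.BalabanUV.Beta.D1BFx.DressedTablesLeg (tadpoleTableA absMoment₂_baseKer_tadpoleTableA)
open Summit.QuantumFields.BalabanUV.Beta.D1BFx.FineHessianSectors (biBubbleTable absMoment₂_baseKer_biBubbleTable)
open Summit.QuantumFields.BalabanUV.Beta.D1BFx.SectorRecut (SbT SbRc exists_biLoc_SbT exists_biLoc_SbRc)
open Summit.QuantumFields.BalabanUV.Beta.D1BFx.GhostAveragingSquare (WghAt)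
open Summit.QuantumFields.BalabanUV.Beta.D1BFx.GhostKernelComplete (biLoc_WghAt_ctr)
open Summit.QuantumFields.BalabanUV.Beta.D1BFx.FrozenLegProfile (gfrz decay_gfrz)
open Summit.QuantumFields.BalabanUV.Beta.D1BFx.SplitInstance (RestIdx)
open Summit.QuantumFields.BalabanUV.Beta.D1BFx.SplitRecut (restK')
open Summit.QuantumFields.BalabanUV.Beta.D1BFx.SplitInstanceS (restKS restKS_tad_eq restKS_bub_eq restKS_gtad_eq restKS_gbub_eq)
open Summit.QuantumFields.BalabanUV.Beta.D1BFx.Assembly (exists_tendsto_psum_const_mul exists_tendsto_psum_finset_sum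
  fullSum_finset_sum_const_mul exists_tendsto_psum_weight_mul)
open Summit.QuantumFields.BalabanUV.Beta.D1BFx.NeedleGroupPointwise (needleFibre' sum_needleFibre' sum_needleFibre sum_needleBub_restK'
  sum_needleGhBub_restK' sum_needleTad_restK' sum_needleGhTad_restK')
open Summit.QuantumFields.BalabanUV.Beta.D1BFx.NeedleRowGlue (conv_bubble conv_tadpoleA biLoc_SbT' biLoc_SbRc' biLoc_ghCur' biLoc_qA')

namespace Summit.QuantumFields.BalabanUV.Beta.D1BFx.NeedleRowGlueS

/-! ## §1 The needle group of the two-profile table at `(b, w)` = the SAME eight profile-free tables -/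

section Pointwise

variable (n : ℕ) [NeZero n] (a : ℝ) {g : Pt → ℝ} (cE cΛ cR cK cQ cE₂ cJ4 cΛ₂ cR₂ cQ₂ x₀ : ℝ) (WE WJ WΛ WR WQ : TableR)
  (ωgl ωgh lam N : ℝ) (μ ν : Fin 4) (b : Pt) {C δ CQ δW : ℝ} (s : ℝ)

/-- [folklore] **THE NEEDLE GROUP OF THE TWO-PROFILE RE-CUT TABLE AT A BASE SITE AND A DISPLACEMENT IS THE SAME THREE GLUON TABLES, THREE GHOST TABLES,
THE COMPLETED GHOST TADPOLE AND THE SLOT-4 TADPOLE OVER THE FULL LEGS** as for the table of record (`NeedleGroupPointwise.sum_needleFibre'_restK'`): the gluon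
bubble and slot-4 tadpole words of the fibre are `restK'`'s at `g` (rfl), the ghost bubble and ghost tadpole words are `restK'`'s at the second profile `s•g`
(rfl) — and each of the four partial recombinations holds for ANY exponentially bounded profile (`s•g` with constant `|s|·C`), so BOTH profiles drop out. -/
theorem sum_needleFibre'_restKS (ha : 0 < a) (hGa : Spr (Ga n a)) (hδ : 0 < δ) (hg : ∀ v, |g v| ≤ C * Real.exp (-δ * l1 v)) (hδW : 0 < δW)
    (hQ : ∀ κ u l u', BiLoc (WQ κ u l u') u u' CQ δW) (w : Pt) :
    ∑ τ ∈ needleFibre', restKS n a g (fun v => s * g v) cE cΛ cR cK cQ cE₂ cJ4 cΛ₂ cR₂ cQ₂ x₀ WE WJ WΛ WR WQ ωgl ωgh lam N μ ν b τ w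
      = ((n : ℝ) ^ 8)⁻¹ * (toReal w μ * toReal w ν *
        (ωgl * (cE * biBubbleTable (Ga n a) (Ga n a) SbT (SbRc n a cE cR cK cQ) μ ν (b + w) b
            + cE * biBubbleTable (Ga n a) (Ga n a) (SbRc n a cE cR cK cQ) SbT μ ν (b + w) b
            + biBubbleTable (Ga n a) (Ga n a) (SbRc n a cE cR cK cQ) (SbRc n a cE cR cK cQ) μ ν (b + w) b)
          + ωgh * (cK * cQ * biBubbleTable (Ggh n a) (Ggh n a) ghCur (qAntiAt (ctrHalf n) n) μ ν (b + w) b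
            + cQ * cK * biBubbleTable (Ggh n a) (Ggh n a) (qAntiAt (ctrHalf n) n) ghCur μ ν (b + w) b
            + cQ * cQ * biBubbleTable (Ggh n a) (Ggh n a) (qAntiAt (ctrHalf n) n) (qAntiAt (ctrHalf n) n) μ ν (b + w) b
            + tadpoleTableA (Ggh n a) (WghAt (ctrHalf n) n x₀ cK cQ) μ ν (b + w) b)
          + ωgl * (cQ₂ * tadpoleTable n a WQ μ ν (b + w) b))) := by
  -- the rescaled profile is exponentially bounded
  have hg' : ∀ v, |s * g v| ≤ |s| * C * Real.exp (-δ * l1 v) := fun v => by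
    rw [abs_mul, mul_assoc]
    exact mul_le_mul_of_nonneg_left (hg v) (abs_nonneg s)
  rw [sum_needleFibre', sum_needleFibre]
  simp only [restKS_bub_eq, restKS_gbub_eq, restKS_tad_eq, restKS_gtad_eq]
  rw [sum_needleBub_restK' n a cE cΛ cR cK cQ cE₂ cJ4 cΛ₂ cR₂ cQ₂ x₀ WE WJ WΛ WR WQ ωgl ωgh lam N μ ν b ha hGa hδ hg w,
    sum_needleGhBub_restK' n a cE cΛ cR cK cQ cE₂ cJ4 cΛ₂ cR₂ cQ₂ x₀ WE WJ WΛ WR WQ ωgl ωgh lam N μ ν b ha hδ hg' w,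
    sum_needleTad_restK' n a cE cΛ cR cK cQ cE₂ cJ4 cΛ₂ cR₂ cQ₂ x₀ WE WJ WΛ WR WQ ωgl ωgh lam N μ ν b hGa hδ hg hδW hQ w,
    sum_needleGhTad_restK' n a cE cΛ cR cK cQ cE₂ cJ4 cΛ₂ cR₂ cQ₂ x₀ WE WJ WΛ WR WQ ωgl ωgh lam N μ ν b ha hδ hg' w]
  ring

end Pointwise

/-! ## §2 The needle group's full sum at a base site = eight profile-free table full sums (two-profile table) -/

section Fixed

variable (n : ℕ) [NeZero n] (a : ℝ) {g : Pt → ℝ} (cE cΛ cR cK cQ cE₂ cJ4 cΛ₂ cR₂ cQ₂ x₀ : ℝ) (WE WJ WΛ WR WQ : TableR)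
  (ωgl ωgh lam N : ℝ) (μ ν : Fin 4) (b : Pt) {C δ CQ δW : ℝ} (s : ℝ)

/-- [folklore] **THE FULL SUM OF THE NEEDLE GROUP OF THE TWO-PROFILE TABLE AT A BASE SITE IS THE SAME FIXED COMBINATION OF EIGHT PROFILE-FREE TABLE FULL
SUMS** (for ANY exponentially bounded profile `g` and ANY scalar `s` — both have dropped out —, `0 < a`, `Spr (Ga n a)`, the slot-4 socket `hQ`):
`fullSum (w ↦ Σ_{τ ∈ needleFibre'} restKS g (s•g) … b τ w) = n⁻⁸ · (ωgl·(cE·FS₁ + cE·FS₂ + FS₃) + ωgh·(cK cQ·FS₄ + cQ cK·FS₅ + cQ cQ·FS₆ + FS₇) + ωgl·(cQ₂·FS₈))`. -/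
theorem fullSum_needleFibre'_eqS (ha : 0 < a) (hGa : Spr (Ga n a)) (hδ : 0 < δ) (hg : ∀ v, |g v| ≤ C * Real.exp (-δ * l1 v)) (hδW : 0 < δW)
    (hQ : ∀ κ u l u', BiLoc (WQ κ u l u') u u' CQ δW) :
    fullSum (fun w : Pt => ∑ τ ∈ needleFibre', restKS n a g (fun v => s * g v) cE cΛ cR cK cQ cE₂ cJ4 cΛ₂ cR₂ cQ₂ x₀ WE WJ WΛ WR WQ ωgl ωgh lam N μ ν b τ w)
      = ((n : ℝ) ^ 8)⁻¹ * (
          ωgl * (cE * fullSum (fun w : Pt => toReal w μ * toReal w ν * biBubbleTable (Ga n a) (Ga n a) SbT (SbRc n a cE cR cK cQ) μ ν (b + w) b)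
            + cE * fullSum (fun w : Pt => toReal w μ * toReal w ν * biBubbleTable (Ga n a) (Ga n a) (SbRc n a cE cR cK cQ) SbT μ ν (b + w) b)
            + fullSum (fun w : Pt => toReal w μ * toReal w ν *
                biBubbleTable (Ga n a) (Ga n a) (SbRc n a cE cR cK cQ) (SbRc n a cE cR cK cQ) μ ν (b + w) b))
        + ωgh * (cK * cQ * fullSum (fun w : Pt => toReal w μ * toReal w ν * biBubbleTable (Ggh n a) (Ggh n a) ghCur (qAntiAt (ctrHalf n) n) μ ν (b + w) b)
            + cQ * cK * fullSum (fun w : Pt => toReal w μ * toReal w ν * biBubbleTable (Ggh n a) (Ggh n a) (qAntiAt (ctrHalf n) n) ghCur μ ν (b + w) b)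
            + cQ * cQ * fullSum (fun w : Pt => toReal w μ * toReal w ν *
                biBubbleTable (Ggh n a) (Ggh n a) (qAntiAt (ctrHalf n) n) (qAntiAt (ctrHalf n) n) μ ν (b + w) b)
            + fullSum (fun w : Pt => toReal w μ * toReal w ν * tadpoleTableA (Ggh n a) (WghAt (ctrHalf n) n x₀ cK cQ) μ ν (b + w) b))
        + ωgl * (cQ₂ * fullSum (fun w : Pt => toReal w μ * toReal w ν * tadpoleTable n a WQ μ ν (b + w) b))) := by
  classical
  have hGgh : Spr (Ggh n a) := spr_Ggh n a ha
  -- the eight profile-free weighted table integrands and their coefficients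
  set K : Fin 8 → Pt → ℝ := ![
      fun w : Pt => toReal w μ * toReal w ν * biBubbleTable (Ga n a) (Ga n a) SbT (SbRc n a cE cR cK cQ) μ ν (b + w) b,
      fun w : Pt => toReal w μ * toReal w ν * biBubbleTable (Ga n a) (Ga n a) (SbRc n a cE cR cK cQ) SbT μ ν (b + w) b,
      fun w : Pt => toReal w μ * toReal w ν * biBubbleTable (Ga n a) (Ga n a) (SbRc n a cE cR cK cQ) (SbRc n a cE cR cK cQ) μ ν (b + w) b,
      fun w : Pt => toReal w μ * toReal w ν * biBubbleTable (Ggh n a) (Ggh n a) ghCur (qAntiAt (ctrHalf n) n) μ ν (b + w) b,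
      fun w : Pt => toReal w μ * toReal w ν * biBubbleTable (Ggh n a) (Ggh n a) (qAntiAt (ctrHalf n) n) ghCur μ ν (b + w) b,
      fun w : Pt => toReal w μ * toReal w ν * biBubbleTable (Ggh n a) (Ggh n a) (qAntiAt (ctrHalf n) n) (qAntiAt (ctrHalf n) n) μ ν (b + w) b,
      fun w : Pt => toReal w μ * toReal w ν * tadpoleTableA (Ggh n a) (WghAt (ctrHalf n) n x₀ cK cQ) μ ν (b + w) b,
      fun w : Pt => toReal w μ * toReal w ν * tadpoleTable n a WQ μ ν (b + w) b] with hK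
  set c : Fin 8 → ℝ := ![ωgl * cE, ωgl * cE, ωgl, ωgh * (cK * cQ), ωgh * (cQ * cK), ωgh * (cQ * cQ), ωgh, ωgl * cQ₂] with hc
  have hconv : ∀ i ∈ (univ : Finset (Fin 8)), ∃ L, Tendsto (psum (K i)) atTop (𝓝 L) := by
    intro i _
    fin_cases i
    · exact conv_bubble hGa hGa biLoc_SbT' (biLoc_SbRc' n a cE cR cK cQ ha) μ ν b
    · exact conv_bubble hGa hGa (biLoc_SbRc' n a cE cR cK cQ ha) biLoc_SbT' μ ν b
    · exact conv_bubble hGa hGa (biLoc_SbRc' n a cE cR cK cQ ha) (biLoc_SbRc' n a cE cR cK cQ ha) μ ν b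
    · exact conv_bubble hGgh hGgh biLoc_ghCur' (biLoc_qA' n) μ ν b
    · exact conv_bubble hGgh hGgh (biLoc_qA' n) biLoc_ghCur' μ ν b
    · exact conv_bubble hGgh hGgh (biLoc_qA' n) (biLoc_qA' n) μ ν b
    · exact conv_tadpoleA hGgh (div_pos one_pos (by exact_mod_cast Nat.pos_of_ne_zero (NeZero.ne n)))
        (biLoc_WghAt_ctr n x₀ cK cQ) μ ν b
    · exact conv_tadpoleA hGa hδW hQ μ ν b
  -- the integrand, pointwise
  have e : (fun w : Pt => ∑ τ ∈ needleFibre', restKS n a g (fun v => s * g v) cE cΛ cR cK cQ cE₂ cJ4 cΛ₂ cR₂ cQ₂ x₀ WE WJ WΛ WR WQ ωgl ωgh lam N μ ν b τ w)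
      = fun w : Pt => ((n : ℝ) ^ 8)⁻¹ * ∑ i : Fin 8, c i * K i w := by
    funext w
    rw [sum_needleFibre'_restKS n a cE cΛ cR cK cQ cE₂ cJ4 cΛ₂ cR₂ cQ₂ x₀ WE WJ WΛ WR WQ ωgl ωgh lam N μ ν b s ha hGa hδ hg hδW hQ w,
      Fin.sum_univ_eight]
    simp only [hK, hc, Matrix.cons_val_zero, Matrix.cons_val_one, Matrix.cons_val]
    ring
  have hsum : ∃ L, Tendsto (psum (fun w : Pt => ∑ i : Fin 8, c i * K i w)) atTop (𝓝 L) :=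
    exists_tendsto_psum_finset_sum _ fun i hi => exists_tendsto_psum_const_mul (c i) (hconv i hi)
  rw [e, fullSum_const_mul _ hsum, fullSum_finset_sum_const_mul univ c hconv, Fin.sum_univ_eight]
  simp only [hK, hc, Matrix.cons_val_zero, Matrix.cons_val_one, Matrix.cons_val]
  ring

end Fixed

/-! ## §3 In the END's currency: the needle row from eight displayed table-row bounds -/

section Packaged

variable {a N : ℝ} {μ ν : Fin 4} {cE cΛ cR cK cQ cE₂ cJ4 cΛ₂ cR₂ cQ₂ x₀ ωgl ωgh : ℕ → ℝ} {WE WJ WΛ WR WQ : ℕ → TableR}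
  {CQ δW : ℕ → ℝ} {G : Type*} [DecidableEq G] {grp : RestIdx → G} {gN : G}

/-- [folklore] **ROAD BF-x, THE NEEDLE ROW OF THE «ENDₛ» END FROM EIGHT TABLE ROWS** (owner «NEEDLE-GLUE-S»; the hypothesis `hGrp` of
`RoadEndBFxTotalShellGroupsS.d1Drift_BFx_total_shell_of_prop12_of_groupsS` at the label value `gN` whose fibre is `needleFibre'`; two-profile words
`restKS (gfrz n a b) (s n • gfrz n a b)`, ANY family `s` — the table rows are profile-free): given `0 < a`, the (α)-leaf
`Spr (Ga n a)` along the block sizes, the slot-4 socket `hQ` (the END's own), the fibre datum `hfib`, and ONE n-uniform bound per table row `h₁ … h₈` — the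
(N-2) currency `coef n · Σ_{b ∈ image resSite} n⁻⁴ · (n⁻⁸ · fullSum (w ↦ w_μ w_ν · T n μ ν (b+w) b))` —, the END's needle row is bounded by `C₁ + ⋯ + C₈`
at every block size `n ≥ 2`.  NOTHING is estimated here. -/
theorem abs_gN_row_le_of_tablesS (hfib : ∀ τ : RestIdx, grp τ = gN ↔ τ ∈ needleFibre') (ha : 0 < a)
    (hGa : ∀ n : ℕ, 2 ≤ n → ∀ [NeZero n], Spr (Ga n a)) (hδW : ∀ n, 0 < δW n)
    (hQ : ∀ n κ u l u', BiLoc (WQ n κ u l u') u u' (CQ n) (δW n)) (s : ℕ → ℝ) {C₁ C₂ C₃ C₄ C₅ C₆ C₇ C₈ : ℝ}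
    (h₁ : ∀ n : ℕ, 2 ≤ n → ∀ [NeZero n], |ωgl n * cE n * ∑ b ∈ (univ : Finset (Fin 4 → Fin n)).image resSite, ((n : ℝ) ^ 4)⁻¹ * (((n : ℝ) ^ 8)⁻¹ *
      fullSum (fun w : Pt => toReal w μ * toReal w ν *
        biBubbleTable (Ga n a) (Ga n a) SbT (SbRc n a (cE n) (cR n) (cK n) (cQ n)) μ ν (b + w) b))| ≤ C₁)
    (h₂ : ∀ n : ℕ, 2 ≤ n → ∀ [NeZero n], |ωgl n * cE n * ∑ b ∈ (univ : Finset (Fin 4 → Fin n)).image resSite, ((n : ℝ) ^ 4)⁻¹ * (((n : ℝ) ^ 8)⁻¹ *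
      fullSum (fun w : Pt => toReal w μ * toReal w ν *
        biBubbleTable (Ga n a) (Ga n a) (SbRc n a (cE n) (cR n) (cK n) (cQ n)) SbT μ ν (b + w) b))| ≤ C₂)
    (h₃ : ∀ n : ℕ, 2 ≤ n → ∀ [NeZero n], |ωgl n * ∑ b ∈ (univ : Finset (Fin 4 → Fin n)).image resSite, ((n : ℝ) ^ 4)⁻¹ * (((n : ℝ) ^ 8)⁻¹ *
      fullSum (fun w : Pt => toReal w μ * toReal w ν *
        biBubbleTable (Ga n a) (Ga n a) (SbRc n a (cE n) (cR n) (cK n) (cQ n)) (SbRc n a (cE n) (cR n) (cK n) (cQ n)) μ ν (b + w) b))| ≤ C₃)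
    (h₄ : ∀ n : ℕ, 2 ≤ n → ∀ [NeZero n], |ωgh n * (cK n * cQ n) * ∑ b ∈ (univ : Finset (Fin 4 → Fin n)).image resSite, ((n : ℝ) ^ 4)⁻¹ *
      (((n : ℝ) ^ 8)⁻¹ * fullSum (fun w : Pt => toReal w μ * toReal w ν *
        biBubbleTable (Ggh n a) (Ggh n a) ghCur (qAntiAt (ctrHalf n) n) μ ν (b + w) b))| ≤ C₄)
    (h₅ : ∀ n : ℕ, 2 ≤ n → ∀ [NeZero n], |ωgh n * (cQ n * cK n) * ∑ b ∈ (univ : Finset (Fin 4 → Fin n)).image resSite, ((n : ℝ) ^ 4)⁻¹ *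
      (((n : ℝ) ^ 8)⁻¹ * fullSum (fun w : Pt => toReal w μ * toReal w ν *
        biBubbleTable (Ggh n a) (Ggh n a) (qAntiAt (ctrHalf n) n) ghCur μ ν (b + w) b))| ≤ C₅)
    (h₆ : ∀ n : ℕ, 2 ≤ n → ∀ [NeZero n], |ωgh n * (cQ n * cQ n) * ∑ b ∈ (univ : Finset (Fin 4 → Fin n)).image resSite, ((n : ℝ) ^ 4)⁻¹ *
      (((n : ℝ) ^ 8)⁻¹ * fullSum (fun w : Pt => toReal w μ * toReal w ν *
        biBubbleTable (Ggh n a) (Ggh n a) (qAntiAt (ctrHalf n) n) (qAntiAt (ctrHalf n) n) μ ν (b + w) b))| ≤ C₆)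
    (h₇ : ∀ n : ℕ, 2 ≤ n → ∀ [NeZero n], |ωgh n * ∑ b ∈ (univ : Finset (Fin 4 → Fin n)).image resSite, ((n : ℝ) ^ 4)⁻¹ * (((n : ℝ) ^ 8)⁻¹ *
      fullSum (fun w : Pt => toReal w μ * toReal w ν *
        tadpoleTableA (Ggh n a) (WghAt (ctrHalf n) n (x₀ n) (cK n) (cQ n)) μ ν (b + w) b))| ≤ C₇)
    (h₈ : ∀ n : ℕ, 2 ≤ n → ∀ [NeZero n], |ωgl n * cQ₂ n * ∑ b ∈ (univ : Finset (Fin 4 → Fin n)).image resSite, ((n : ℝ) ^ 4)⁻¹ * (((n : ℝ) ^ 8)⁻¹ *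
      fullSum (fun w : Pt => toReal w μ * toReal w ν * tadpoleTable n a (WQ n) μ ν (b + w) b))| ≤ C₈) :
    ∀ n : ℕ, 2 ≤ n → ∀ [NeZero n],
      |∑ b ∈ (univ : Finset (Fin 4 → Fin n)).image resSite, ((n : ℝ) ^ 4)⁻¹ *
        fullSum (fun w : Pt => ∑ τ ∈ (univ : Finset RestIdx).filter (fun τ => grp τ = gN),
          restKS n a (gfrz n a b) (fun v => s n * gfrz n a b v) (cE n) (cΛ n) (cR n) (cK n) (cQ n) (cE₂ n) (cJ4 n) (cΛ₂ n) (cR₂ n) (cQ₂ n) (x₀ n)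
            (WE n) (WJ n) (WΛ n) (WR n) (WQ n) (ωgl n) (ωgh n) ((n : ℝ) ^ 8) N μ ν b τ w)|
        ≤ C₁ + C₂ + C₃ + C₄ + C₅ + C₆ + C₇ + C₈ := by
  intro n hn _
  classical
  -- the fibre of `gN` is the needle fibre of record
  have hset : (univ : Finset RestIdx).filter (fun τ => grp τ = gN) = needleFibre' := by
    ext τ
    simp only [mem_filter, mem_univ, true_and]
    exact hfib τ
  -- the eight table rows (with their coefficients) and their bounds
  set Y : Fin 8 → ℝ := ![
      ωgl n * cE n * ∑ b ∈ (univ : Finset (Fin 4 → Fin n)).image resSite, ((n : ℝ) ^ 4)⁻¹ * (((n : ℝ) ^ 8)⁻¹ *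
        fullSum (fun w : Pt => toReal w μ * toReal w ν * biBubbleTable (Ga n a) (Ga n a) SbT (SbRc n a (cE n) (cR n) (cK n) (cQ n)) μ ν (b + w) b)),
      ωgl n * cE n * ∑ b ∈ (univ : Finset (Fin 4 → Fin n)).image resSite, ((n : ℝ) ^ 4)⁻¹ * (((n : ℝ) ^ 8)⁻¹ *
        fullSum (fun w : Pt => toReal w μ * toReal w ν * biBubbleTable (Ga n a) (Ga n a) (SbRc n a (cE n) (cR n) (cK n) (cQ n)) SbT μ ν (b + w) b)),
      ωgl n * ∑ b ∈ (univ : Finset (Fin 4 → Fin n)).image resSite, ((n : ℝ) ^ 4)⁻¹ * (((n : ℝ) ^ 8)⁻¹ *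
        fullSum (fun w : Pt => toReal w μ * toReal w ν *
          biBubbleTable (Ga n a) (Ga n a) (SbRc n a (cE n) (cR n) (cK n) (cQ n)) (SbRc n a (cE n) (cR n) (cK n) (cQ n)) μ ν (b + w) b)),
      ωgh n * (cK n * cQ n) * ∑ b ∈ (univ : Finset (Fin 4 → Fin n)).image resSite, ((n : ℝ) ^ 4)⁻¹ * (((n : ℝ) ^ 8)⁻¹ *
        fullSum (fun w : Pt => toReal w μ * toReal w ν * biBubbleTable (Ggh n a) (Ggh n a) ghCur (qAntiAt (ctrHalf n) n) μ ν (b + w) b)),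
      ωgh n * (cQ n * cK n) * ∑ b ∈ (univ : Finset (Fin 4 → Fin n)).image resSite, ((n : ℝ) ^ 4)⁻¹ * (((n : ℝ) ^ 8)⁻¹ *
        fullSum (fun w : Pt => toReal w μ * toReal w ν * biBubbleTable (Ggh n a) (Ggh n a) (qAntiAt (ctrHalf n) n) ghCur μ ν (b + w) b)),
      ωgh n * (cQ n * cQ n) * ∑ b ∈ (univ : Finset (Fin 4 → Fin n)).image resSite, ((n : ℝ) ^ 4)⁻¹ * (((n : ℝ) ^ 8)⁻¹ *
        fullSum (fun w : Pt => toReal w μ * toReal w ν *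
          biBubbleTable (Ggh n a) (Ggh n a) (qAntiAt (ctrHalf n) n) (qAntiAt (ctrHalf n) n) μ ν (b + w) b)),
      ωgh n * ∑ b ∈ (univ : Finset (Fin 4 → Fin n)).image resSite, ((n : ℝ) ^ 4)⁻¹ * (((n : ℝ) ^ 8)⁻¹ *
        fullSum (fun w : Pt => toReal w μ * toReal w ν * tadpoleTableA (Ggh n a) (WghAt (ctrHalf n) n (x₀ n) (cK n) (cQ n)) μ ν (b + w) b)),
      ωgl n * cQ₂ n * ∑ b ∈ (univ : Finset (Fin 4 → Fin n)).image resSite, ((n : ℝ) ^ 4)⁻¹ * (((n : ℝ) ^ 8)⁻¹ *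
        fullSum (fun w : Pt => toReal w μ * toReal w ν * tadpoleTable n a (WQ n) μ ν (b + w) b))] with hY
  set Cv : Fin 8 → ℝ := ![C₁, C₂, C₃, C₄, C₅, C₆, C₇, C₈] with hCv
  have hYle : ∀ i ∈ (univ : Finset (Fin 8)), |Y i| ≤ Cv i := by
    intro i _
    fin_cases i
    · exact h₁ n hn
    · exact h₂ n hn
    · exact h₃ n hn
    · exact h₄ n hn
    · exact h₅ n hn
    · exact h₆ n hn
    · exact h₇ n hn
    · exact h₈ n hn
  -- the row, base site by base site, through §2 at the frozen profile
  have hrow : ∑ b ∈ (univ : Finset (Fin 4 → Fin n)).image resSite, ((n : ℝ) ^ 4)⁻¹ *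
      fullSum (fun w : Pt => ∑ τ ∈ (univ : Finset RestIdx).filter (fun τ => grp τ = gN),
        restKS n a (gfrz n a b) (fun v => s n * gfrz n a b v) (cE n) (cΛ n) (cR n) (cK n) (cQ n) (cE₂ n) (cJ4 n) (cΛ₂ n) (cR₂ n) (cQ₂ n) (x₀ n)
          (WE n) (WJ n) (WΛ n) (WR n) (WQ n) (ωgl n) (ωgh n) ((n : ℝ) ^ 8) N μ ν b τ w)
      = ∑ i : Fin 8, Y i := by
    rw [hset]
    have hb : ∀ b ∈ (univ : Finset (Fin 4 → Fin n)).image resSite, ((n : ℝ) ^ 4)⁻¹ *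
        fullSum (fun w : Pt => ∑ τ ∈ needleFibre',
          restKS n a (gfrz n a b) (fun v => s n * gfrz n a b v) (cE n) (cΛ n) (cR n) (cK n) (cQ n) (cE₂ n) (cJ4 n) (cΛ₂ n) (cR₂ n) (cQ₂ n) (x₀ n)
            (WE n) (WJ n) (WΛ n) (WR n) (WQ n) (ωgl n) (ωgh n) ((n : ℝ) ^ 8) N μ ν b τ w)
        = (ωgl n * cE n) * (((n : ℝ) ^ 4)⁻¹ * (((n : ℝ) ^ 8)⁻¹ *
            fullSum (fun w : Pt => toReal w μ * toReal w ν * biBubbleTable (Ga n a) (Ga n a) SbT (SbRc n a (cE n) (cR n) (cK n) (cQ n)) μ ν (b + w) b)))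
          + (ωgl n * cE n) * (((n : ℝ) ^ 4)⁻¹ * (((n : ℝ) ^ 8)⁻¹ *
            fullSum (fun w : Pt => toReal w μ * toReal w ν * biBubbleTable (Ga n a) (Ga n a) (SbRc n a (cE n) (cR n) (cK n) (cQ n)) SbT μ ν (b + w) b)))
          + ωgl n * (((n : ℝ) ^ 4)⁻¹ * (((n : ℝ) ^ 8)⁻¹ *
            fullSum (fun w : Pt => toReal w μ * toReal w ν *
              biBubbleTable (Ga n a) (Ga n a) (SbRc n a (cE n) (cR n) (cK n) (cQ n)) (SbRc n a (cE n) (cR n) (cK n) (cQ n)) μ ν (b + w) b)))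
          + (ωgh n * (cK n * cQ n)) * (((n : ℝ) ^ 4)⁻¹ * (((n : ℝ) ^ 8)⁻¹ *
            fullSum (fun w : Pt => toReal w μ * toReal w ν * biBubbleTable (Ggh n a) (Ggh n a) ghCur (qAntiAt (ctrHalf n) n) μ ν (b + w) b)))
          + (ωgh n * (cQ n * cK n)) * (((n : ℝ) ^ 4)⁻¹ * (((n : ℝ) ^ 8)⁻¹ *
            fullSum (fun w : Pt => toReal w μ * toReal w ν * biBubbleTable (Ggh n a) (Ggh n a) (qAntiAt (ctrHalf n) n) ghCur μ ν (b + w) b)))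
          + (ωgh n * (cQ n * cQ n)) * (((n : ℝ) ^ 4)⁻¹ * (((n : ℝ) ^ 8)⁻¹ *
            fullSum (fun w : Pt => toReal w μ * toReal w ν *
              biBubbleTable (Ggh n a) (Ggh n a) (qAntiAt (ctrHalf n) n) (qAntiAt (ctrHalf n) n) μ ν (b + w) b)))
          + ωgh n * (((n : ℝ) ^ 4)⁻¹ * (((n : ℝ) ^ 8)⁻¹ *
            fullSum (fun w : Pt => toReal w μ * toReal w ν * tadpoleTableA (Ggh n a) (WghAt (ctrHalf n) n (x₀ n) (cK n) (cQ n)) μ ν (b + w) b)))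
          + (ωgl n * cQ₂ n) * (((n : ℝ) ^ 4)⁻¹ * (((n : ℝ) ^ 8)⁻¹ *
            fullSum (fun w : Pt => toReal w μ * toReal w ν * tadpoleTable n a (WQ n) μ ν (b + w) b))) := by
      intro b _
      obtain ⟨C', δ', hδ', hgb⟩ := decay_gfrz (hGa n hn) b
      rw [fullSum_needleFibre'_eqS n a (cE n) (cΛ n) (cR n) (cK n) (cQ n) (cE₂ n) (cJ4 n) (cΛ₂ n) (cR₂ n) (cQ₂ n) (x₀ n) (WE n) (WJ n) (WΛ n)
        (WR n) (WQ n) (ωgl n) (ωgh n) ((n : ℝ) ^ 8) N μ ν b (s n) ha (hGa n hn) hδ' hgb (hδW n) (hQ n)]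
      ring
    rw [sum_congr rfl hb, sum_add_distrib, sum_add_distrib, sum_add_distrib, sum_add_distrib, sum_add_distrib, sum_add_distrib,
      sum_add_distrib, Fin.sum_univ_eight]
    simp only [hY, Matrix.cons_val_zero, Matrix.cons_val_one, Matrix.cons_val, mul_sum]
  rw [hrow]
  calc |∑ i : Fin 8, Y i| ≤ ∑ i : Fin 8, |Y i| := abs_sum_le_sum_abs _ _
    _ ≤ ∑ i : Fin 8, Cv i := sum_le_sum hYle
    _ = C₁ + C₂ + C₃ + C₄ + C₅ + C₆ + C₇ + C₈ := by
      rw [Fin.sum_univ_eight]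
      simp only [hCv, Matrix.cons_val_zero, Matrix.cons_val_one, Matrix.cons_val]

end Packaged

end Summit.QuantumFields.BalabanUV.Beta.D1BFx.NeedleRowGlueS

end
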